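import Literature.Analysis.FluidPDE.OseenSliceHolder
import Literature.Analysis.FluidPDE.NSBoundedMildOseen
import Literature.Analysis.FunctionSpaces.DominatedIteratedDeriv
import Mathlib.Analysis.SpecialFunctions.Integrals.Basic
import HarnessLib

/-!
# KNSS 2009, §4: spatial regularity of drift-mild velocity fields (the bootstrap, proved)

Analysis/FluidPDE proofs file on the discharge path of the named facts
`KNSS2009_regularity_boundedWeak_ancient_planar` (`KNSSRegularityPlanar`) and
`KNSS2009_driftMild_regularity` (`KNSSRegularityDecomposition`): Koch–Nadirashvili–Seregin–Šverák,
Acta Math. 203 (2009) = arXiv:0709.3599v1, §4, closing paragraph, the bounds (4.10)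
`‖∇ᵏₓu‖_{L^∞(ℝⁿ×(δ,T))} ≤ C(k, δ, T, M)` for a bounded weak solution decomposed by Lemma 3.1 as
`u = v + w + b(t)`. The source derives them from Proposition 4.1 (smoothing of mild solutions,
"proved in the same way as the corresponding results in [GigaSawada], [DongDu],
[GermainPavlovicStaffilani] … The key is an estimate of `B` with the same form as (4.5) but in
spaces with norms given by `‖t^{k/2}∇ᵏₓu‖`"), the `L^p` estimate (3.13) and Serrin's bootstrap
on the vorticity equation. Here they are **proved**, in any finite-dimensional `E`, for every
**drift-mild pair** `(U, b)` — the form in which §4 consumes Lemma 3.1: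
`U(t) = e^{(t−s)Δ}U(s) − ∫ₛᵗ e^{(t−τ)Δ}P∇·(u ⊗ u)(τ) dτ`, `u = U + b(τ)`, `s₀ < s < t < T`, with
`U`, `b` bounded by `N` (`IsDriftMildOn`) — by an elementary Hölder-space bootstrap on the mild
formula which replaces the `L^p`/Serrin route of the source:

* level `0`: `U(t) ∈ C^{0,1/2}` on `(s₀ + δ, T)` with constant `A₀(δ, N)` (the heat part is
  Lipschitz, `‖∇e^{dΔ}‖ ≲ d^{-1/2}`; the Duhamel part has increments
  `≤ ∫ min(2C₀σ^{-1/2}, C₁σ⁻¹r) ≤ ∫ √(2C₀C₁) σ^{-3/4} r^{1/2}`);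
* level `k → k + 1` (`exists_isHolderField_of_isDriftMildOn`): if `U(τ) ∈ C^{k,1/2}` uniformly on
  `(s₀ + δ/2, T)` then `U(t) ∈ C^{k+1,1/2}` uniformly on `(s₀ + δ, T)`: restart the mild formula at
  `s = t − δ/2`; the heat part gains any number of derivatives (`HeatIteratedDerivBounds`); the
  Duhamel part `∫ N_{t−τ}[u(τ), u(τ)] dτ` is differentiated `k + 1` times under the integral
  (`DominatedIteratedDeriv`) thanks to the **Hölder gain** `‖Dᵏ⁺¹N_σ‖ ≲ σ^{-3/4}`,
  `‖Dᵏ⁺²N_σ‖ ≲ σ^{-5/4}` of `OseenSliceHolder`, and its `(k+1)`-st derivative is again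
  `1/2`-Hölder by the *lossless splitting* `∫ min(2σ^{-3/4}, rσ^{-5/4}) dσ ≤ 12 r^{1/2}`;
* hence (`IsDriftMildOn.contDiff`, `IsDriftMildOn.exists_norm_iteratedFDeriv_le`): every slice
  `U(t)`, `t ∈ (s₀, T)`, is `C^∞`, and for all `k, δ, N` there is `C(k, δ, N)` — independent of
  the pair, of `s₀` and of `T` — with `‖DᵏU(t)(x)‖ ≤ C` for `t ∈ (s₀ + δ, T)`: KNSS's (4.10).

Divergence-freeness plays no role at this stage and is not assumed. The time regularity (4.11)
and the vorticity equation are treated elsewhere.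

## References

* G. Koch, N. Nadirashvili, G. Seregin, V. Šverák, *Liouville theorems for the Navier–Stokes
  equations and applications*, Acta Math. 203 (2009) 83–105 = arXiv:0709.3599v1: §3 Lemma 3.1,
  (3.12)–(3.14); §4 p. 8 (`B(u,v)`, (4.5), Prop. 4.1, Remark 4.2, and the closing paragraph
  with (4.7)–(4.10)). [KochNadirashviliSereginSverak2009]
-/

noncomputable section

open MeasureTheory Set Function Filter Metric Real intervalIntegral
open _root_.Topology
open scoped ENNReal NNReal RealInnerProductSpace ContDiff

namespace Literature.Analysis.FluidPDE

open UnboundedOperators (heatKernel heatExtension)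
open FunctionSpaces (contDiff_integral_of_dominated_iteratedFDeriv norm_iteratedFDeriv_integral_le
  norm_iteratedFDeriv_integral_sub_le stronglyMeasurable_iteratedFDeriv_param)

/-! ### Real-variable lemmas: power integrals on `(s, t)`, geometric mean, splitting -/

section RealLemmas

/-- **Power integrals against the parabolic clock**: for `s < t` and `e > −1`,
`τ ↦ (t − τ)ᵉ` is integrable on `(s, t)` and `∫_{(s,t)} (t − τ)ᵉ dτ = (t − s)^{e+1}/(e + 1)`
(substitution `σ = t − τ`). [folklore] -/
theorem integrableOn_Ioo_sub_rpow_and_integral_eq {s t e : ℝ} (hst : s < t) (he : -1 < e) :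
    IntegrableOn (fun τ => (t - τ) ^ e) (Ioo s t) ∧
      ∫ τ in Ioo s t, (t - τ) ^ e = (t - s) ^ (e + 1) / (e + 1) := by
  have hii : IntervalIntegrable (fun τ => (t - τ) ^ e) volume s t := by
    have h := (intervalIntegral.intervalIntegrable_rpow' (a := 0) (b := t - s) he).comp_sub_left t
    simp only [sub_zero, sub_sub_cancel] at h
    exact h.symm
  have hIoc : IntegrableOn (fun τ => (t - τ) ^ e) (Ioc s t) := hii.1
  refine ⟨hIoc.mono_set Ioo_subset_Ioc_self, ?_⟩
  rw [setIntegral_congr_set (Ioo_ae_eq_Ioc (μ := (volume : Measure ℝ))),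
    ← intervalIntegral.integral_of_le hst.le,
    intervalIntegral.integral_comp_sub_left (fun σ => σ ^ e) t, sub_self,
    integral_rpow (Or.inl he), Real.zero_rpow (by linarith), sub_zero]

/-- `∫_{(s,t)} (t − τ)^{-1/2} dτ = 2 (t − s)^{1/2}`. [folklore] -/
theorem integral_Ioo_sub_rpow_neg_half {s t : ℝ} (hst : s < t) :
    ∫ τ in Ioo s t, (t - τ) ^ (-(1 / 2 : ℝ)) = 2 * (t - s) ^ (1 / 2 : ℝ) := by
  rw [(integrableOn_Ioo_sub_rpow_and_integral_eq hst (by norm_num)).2]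
  norm_num
  ring

/-- `∫_{(s,t)} (t − τ)^{-3/4} dτ = 4 (t − s)^{1/4}`. [folklore] -/
theorem integral_Ioo_sub_rpow_neg_three_quarters {s t : ℝ} (hst : s < t) :
    ∫ τ in Ioo s t, (t - τ) ^ (-(3 / 4 : ℝ)) = 4 * (t - s) ^ (1 / 4 : ℝ) := by
  rw [(integrableOn_Ioo_sub_rpow_and_integral_eq hst (by norm_num)).2]
  norm_num
  ring

/-- The minimum of two nonnegative reals is at most their geometric mean. [folklore] -/
theorem min_le_sqrt_mul {x y : ℝ} (hx : 0 ≤ x) (hy : 0 ≤ y) : min x y ≤ Real.sqrt (x * y) := by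
  rw [Real.le_sqrt (le_min hx hy) (mul_nonneg hx hy)]
  rcases le_total x y with h | h
  · rw [min_eq_left h, sq]; exact mul_le_mul_of_nonneg_left h hx
  · rw [min_eq_right h, sq]; exact mul_le_mul_of_nonneg_right h hy

/-- `(r²)^{e} = r^{2e}` for `r > 0`. [folklore] -/
theorem sq_rpow_eq {r : ℝ} (hr : 0 < r) (e : ℝ) : (r ^ 2) ^ e = r ^ (2 * e) := by
  rw [Real.rpow_mul hr.le, Real.rpow_two]

/-- **The lossless splitting integral** behind the persistence of the Hölder exponent `1/2` in
the bootstrap: for `s < t` and `r > 0`,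
`∫_{(s,t)} min(2(t−τ)^{-3/4}, r(t−τ)^{-5/4}) dτ ≤ 12 r^{1/2}` (split at `t − τ = r²`: near the
final time the first bound integrates to `≤ 8 (r²)^{1/4}`, away from it the second to
`≤ 4 r (r²)^{-1/4}`), together with the integrability of the integrand. [folklore] -/
theorem integral_Ioo_min_rpow_le {s t r : ℝ} (hst : s < t) (hr : 0 < r) :
    IntegrableOn (fun τ => min (2 * (t - τ) ^ (-(3 / 4 : ℝ))) (r * (t - τ) ^ (-(5 / 4 : ℝ))))
        (Ioo s t) ∧
      ∫ τ in Ioo s t, min (2 * (t - τ) ^ (-(3 / 4 : ℝ))) (r * (t - τ) ^ (-(5 / 4 : ℝ))) ≤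
        12 * r ^ (1 / 2 : ℝ) := by
  set f : ℝ → ℝ := fun τ => min (2 * (t - τ) ^ (-(3 / 4 : ℝ))) (r * (t - τ) ^ (-(5 / 4 : ℝ)))
    with hf
  set m : ℝ := t - r ^ 2 with hm
  have hmt : m < t := by rw [hm]; nlinarith
  -- the two majorants
  set F₁ : ℝ → ℝ := (Ioi m).indicator fun τ => 2 * (t - τ) ^ (-(3 / 4 : ℝ)) with hF₁
  set F₂ : ℝ → ℝ := (Iic m).indicator fun τ => r * (t - τ) ^ (-(5 / 4 : ℝ)) with hF₂
  obtain ⟨hI1, -⟩ := integrableOn_Ioo_sub_rpow_and_integral_eq (e := -(3 / 4 : ℝ)) hst (by norm_num)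
  have hfm : AEStronglyMeasurable f (volume.restrict (Ioo s t)) := by
    refine Measurable.aestronglyMeasurable (Measurable.min ?_ ?_)
    · exact measurable_const.mul ((measurable_const.sub measurable_id).pow_const _)
    · exact measurable_const.mul ((measurable_const.sub measurable_id).pow_const _)
  have hf0 : ∀ τ ∈ Ioo s t, 0 ≤ f τ := fun τ hτ => by
    have : 0 < t - τ := sub_pos.2 hτ.2
    exact le_min (by positivity) (by positivity)
  have hint : IntegrableOn f (Ioo s t) := by
    refine Integrable.mono' (hI1.const_mul 2) hfm ?_
    filter_upwards [ae_restrict_mem measurableSet_Ioo] with τ hτ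
    rw [Real.norm_of_nonneg (hf0 τ hτ)]
    exact min_le_left _ _
  refine ⟨hint, ?_⟩
  -- pointwise: `f ≤ F₁ + F₂` on `(s, t)`
  have hle : ∀ τ ∈ Ioo s t, f τ ≤ F₁ τ + F₂ τ := by
    intro τ hτ
    by_cases h : m < τ
    · have h1 : F₁ τ = 2 * (t - τ) ^ (-(3 / 4 : ℝ)) := indicator_of_mem (mem_Ioi.2 h) _
      have h2 : F₂ τ = 0 := indicator_of_notMem (fun h' => not_le.2 h (mem_Iic.1 h')) _
      rw [h1, h2, add_zero]; exact min_le_left _ _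
    · have h1 : F₁ τ = 0 := indicator_of_notMem (fun h' => h (mem_Ioi.1 h')) _
      have h2 : F₂ τ = r * (t - τ) ^ (-(5 / 4 : ℝ)) := indicator_of_mem (mem_Iic.2 (not_lt.1 h)) _
      rw [h1, h2, zero_add]; exact min_le_right _ _
  -- the first majorant
  obtain ⟨hJ1, -⟩ := integrableOn_Ioo_sub_rpow_and_integral_eq (e := -(3 / 4 : ℝ)) hmt (by norm_num)
  have hF₁int : IntegrableOn F₁ (Ioo s t) := by
    rw [hF₁, IntegrableOn, integrable_indicator_iff measurableSet_Ioi, IntegrableOn,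
      Measure.restrict_restrict measurableSet_Ioi]
    refine IntegrableOn.mono_set (hJ1.const_mul 2) ?_
    rintro τ ⟨h1, h2⟩; exact ⟨mem_Ioi.1 h1, h2.2⟩
  have hF₁val : ∫ τ in Ioo s t, F₁ τ ≤ 8 * r ^ (1 / 2 : ℝ) := by
    rw [hF₁, setIntegral_indicator measurableSet_Ioi]
    calc ∫ τ in Ioo s t ∩ Ioi m, 2 * (t - τ) ^ (-(3 / 4 : ℝ))
        ≤ ∫ τ in Ioo m t, 2 * (t - τ) ^ (-(3 / 4 : ℝ)) := by
          refine setIntegral_mono_set (hJ1.const_mul 2) ?_ (Eventually.of_forall ?_)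
          · filter_upwards [ae_restrict_mem measurableSet_Ioo] with τ hτ
            have : 0 < t - τ := sub_pos.2 hτ.2
            positivity
          · rintro τ ⟨⟨-, h2⟩, h1⟩; exact ⟨mem_Ioi.1 h1, h2⟩
      _ = 2 * (4 * (t - m) ^ (1 / 4 : ℝ)) := by
          rw [MeasureTheory.integral_const_mul, integral_Ioo_sub_rpow_neg_three_quarters hmt]
      _ = 8 * r ^ (1 / 2 : ℝ) := by
          rw [hm, sub_sub_cancel, sq_rpow_eq hr]; norm_num; ring
  -- the second majorant
  have hset : Ioo s t ∩ Iic m = Ioc s m := by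
    ext τ
    simp only [mem_inter_iff, mem_Ioo, mem_Iic, mem_Ioc]
    constructor
    · rintro ⟨⟨h1, -⟩, h3⟩; exact ⟨h1, h3⟩
    · rintro ⟨h1, h3⟩; exact ⟨⟨h1, h3.trans_lt hmt⟩, h3⟩
  have hpow : ∀ τ ≤ m, 0 < t - τ := fun τ hτ => by linarith
  have hF₂int : IntegrableOn F₂ (Ioo s t) := by
    rw [hF₂, IntegrableOn, integrable_indicator_iff measurableSet_Iic, IntegrableOn,
      Measure.restrict_restrict measurableSet_Iic, inter_comm, hset]
    refine (ContinuousOn.integrableOn_Icc ?_).mono_set Ioc_subset_Icc_self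
    exact continuousOn_const.mul ((continuousOn_const.sub continuousOn_id).rpow_const
      fun τ hτ => Or.inl (ne_of_gt (hpow τ hτ.2)))
  have hF₂val : ∫ τ in Ioo s t, F₂ τ ≤ 4 * r ^ (1 / 2 : ℝ) := by
    rw [hF₂, setIntegral_indicator measurableSet_Iic, hset]
    rcases le_or_gt m s with hms | hms
    · rw [Ioc_eq_empty (not_lt.2 hms), Measure.restrict_empty, integral_zero_measure]
      positivity
    · rw [← intervalIntegral.integral_of_le hms.le, intervalIntegral.integral_const_mul,
        intervalIntegral.integral_comp_sub_left (fun σ => σ ^ (-(5 / 4 : ℝ))) t,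
        integral_rpow (Or.inr ⟨by norm_num, ?_⟩)]
      · have htm : t - m = r ^ 2 := by rw [hm, sub_sub_cancel]
        rw [htm, sq_rpow_eq hr]
        have hts : 0 < t - s := sub_pos.2 hst
        have h1 : r * (((t - s) ^ (-(5 / 4 : ℝ) + 1) - r ^ (2 * (-(5 / 4 : ℝ) + 1))) /
            (-(5 / 4 : ℝ) + 1)) = 4 * (r * r ^ (-(1 / 2 : ℝ))) - 4 * r * (t - s) ^ (-(1 / 4 : ℝ)) := by
          norm_num; ring
        rw [h1, ← Real.rpow_one_add' hr.le (by norm_num)]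
        norm_num
        positivity
      · rw [uIcc_of_le (by linarith)]
        exact fun h => (lt_irrefl (0 : ℝ)) (lt_of_lt_of_le (by positivity : (0 : ℝ) < t - m) h.1)
  -- conclusion
  calc ∫ τ in Ioo s t, f τ ≤ ∫ τ in Ioo s t, (F₁ τ + F₂ τ) := by
        refine setIntegral_mono_on hint (hF₁int.add hF₂int) measurableSet_Ioo hle
    _ = (∫ τ in Ioo s t, F₁ τ) + ∫ τ in Ioo s t, F₂ τ := integral_add hF₁int hF₂int
    _ ≤ 8 * r ^ (1 / 2 : ℝ) + 4 * r ^ (1 / 2 : ℝ) := add_le_add hF₁val hF₂val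
    _ = 12 * r ^ (1 / 2 : ℝ) := by ring

/-- `min a b ≤ c` as soon as `a b ≤ c²` (`a, b, c ≥ 0`): the geometric-mean bound in squared
form, which avoids square roots of products. [folklore] -/
theorem min_le_of_mul_le_sq {a b c : ℝ} (ha : 0 ≤ a) (hb : 0 ≤ b) (hc : 0 ≤ c)
    (h : a * b ≤ c ^ 2) : min a b ≤ c := by
  have hmin : 0 ≤ min a b := le_min ha hb
  have hsq : (min a b) ^ 2 ≤ c ^ 2 := by
    rcases le_total a b with hab | hab
    · rw [min_eq_left hab, sq]; exact (mul_le_mul_of_nonneg_left hab ha).trans h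
    · rw [min_eq_right hab, sq]; exact (mul_le_mul_of_nonneg_right hab hb).trans h
  exact le_of_sq_le_sq hsq hc

end RealLemmas

variable {E : Type*} [NormedAddCommGroup E] [InnerProductSpace ℝ E] [FiniteDimensional ℝ E]
  [MeasurableSpace E] [BorelSpace E]

/-! ### Mean value for iterated derivatives -/

section MeanValue

omit [FiniteDimensional ℝ E] [MeasurableSpace E] [BorelSpace E] in
/-- **Mean value inequality for the `j`-th derivative**: if `f ∈ Cʲ⁺¹` and `‖Dʲ⁺¹f‖ ≤ B`
everywhere, then `‖Dʲf(x) − Dʲf(y)‖ ≤ B‖x − y‖`. [folklore] -/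
theorem norm_iteratedFDeriv_sub_le_of_bound {F : Type*} [NormedAddCommGroup F] [NormedSpace ℝ F]
    {f : E → F} {j : ℕ} (hf : ContDiff ℝ (j + 1 : ℕ) f) {B : ℝ}
    (hB : ∀ z, ‖iteratedFDeriv ℝ (j + 1) f z‖ ≤ B) (x y : E) :
    ‖iteratedFDeriv ℝ j f x - iteratedFDeriv ℝ j f y‖ ≤ B * ‖x - y‖ := by
  have hdiff : Differentiable ℝ (iteratedFDeriv ℝ j f) :=
    hf.differentiable_iteratedFDeriv (by exact_mod_cast Nat.lt_succ_self j)
  refine Convex.norm_image_sub_le_of_norm_fderiv_le (s := univ) (fun z _ => hdiff z)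
    (fun z _ => ?_) convex_univ (mem_univ y) (mem_univ x)
  rw [norm_fderiv_iteratedFDeriv]
  exact hB z

end MeanValue

/-! ### Drift-mild pairs -/

section DriftMild

/-- **Drift-mild velocity fields on `(s₀, T)` with bound `N`** — the output of KNSS's Lemma 3.1
for a bounded weak Navier–Stokes solution `u = U + b(t)` (`U = v + w`), in the form consumed by the
closing paragraph of §4: `U` jointly measurable with `‖U(t, x)‖ ≤ N` on `(s₀, T) × E`, `b`
measurable with `‖b(t)‖ ≤ N`, and the **drift-mild identity**
`U(t) = e^{(t−s)Δ}U(s) − ∫ₛᵗ e^{(t−τ)Δ}P∇·(u ⊗ u)(τ) dτ` (`u = U + b`, viscosity `1`, the Duhamel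
term being the tree's `oseenDuhamel 1 s u u t`) for all `s₀ < s < t < T` and all `x` ((3.3) for `v`
restarted at `s` by the semigroup law, `w(t) = e^{(t−s)Δ}w(s)`, and `e^{τΔ}P∇·` killing the
spatially constant `b`). Divergence-freeness is not part of the structure (it plays no role in the
spatial bootstrap). The `ℝ³` sibling `IsKNSSDriftMild` (`KNSSRegularityDecomposition`) renders the
same identity through `oseenHeat` on the window `(0, T)`. [cite: KochNadirashviliSereginSverak2009, Lemma 3.1 with (3.3), (3.17)–(3.18), Remark 3.1; §4 p. 8 (arXiv:0709.3599v1)] -/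
structure IsDriftMildOn (s₀ T N : ℝ) (U : ℝ → E → E) (b : ℝ → E) : Prop where
  /-- `U` is jointly measurable in `(t, x)`. -/
  measurable : Measurable (uncurry U)
  /-- the drift `b` is measurable. -/
  measurable_drift : Measurable b
  /-- `U` is bounded by `N` on the window. -/
  norm_le : ∀ t ∈ Ioo s₀ T, ∀ x, ‖U t x‖ ≤ N
  /-- the drift is bounded by `N`. -/
  norm_drift_le : ∀ t, ‖b t‖ ≤ N
  /-- the drift-mild identity between any two times of the window, at every point. -/
  mild : ∀ ⦃s t : ℝ⦄, s₀ < s → s < t → t < T → ∀ x,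
    U t x = heatExtension (U s) (t - s) x -
      oseenDuhamel 1 s (fun τ y => U τ y + b τ) (fun τ y => U τ y + b τ) t x

variable {s₀ T N : ℝ} {U : ℝ → E → E} {b : ℝ → E}

/-- Slices of a drift-mild field are measurable. [folklore] -/
theorem IsDriftMildOn.measurable_slice (h : IsDriftMildOn s₀ T N U b) (t : ℝ) :
    Measurable (U t) :=
  h.measurable.comp (measurable_const.prodMk measurable_id)

/-- The full velocity `u = U + b` of a drift-mild pair is jointly measurable. [folklore] -/
theorem IsDriftMildOn.measurable_full (h : IsDriftMildOn s₀ T N U b) :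
    Measurable (uncurry fun τ y => U τ y + b τ) :=
  h.measurable.add (h.measurable_drift.comp measurable_fst)

/-- The bound `N` of a drift-mild pair is nonnegative. [folklore] -/
theorem IsDriftMildOn.nonneg (h : IsDriftMildOn s₀ T N U b) : 0 ≤ N :=
  (norm_nonneg _).trans (h.norm_drift_le 0)

/-- The full velocity `u = U + b` is bounded by `2N` on the window. [folklore] -/
theorem IsDriftMildOn.norm_full_le (h : IsDriftMildOn s₀ T N U b) {τ : ℝ} (hτ : τ ∈ Ioo s₀ T)
    (y : E) : ‖U τ y + b τ‖ ≤ 2 * N :=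
  (norm_add_le _ _).trans (by linarith [h.norm_le τ hτ y, h.norm_drift_le τ])

/-- Restriction of the window. [folklore] -/
theorem IsDriftMildOn.mono (h : IsDriftMildOn s₀ T N U b) {s₁ : ℝ} (hs : s₀ ≤ s₁) :
    IsDriftMildOn s₁ T N U b where
  measurable := h.measurable
  measurable_drift := h.measurable_drift
  norm_le := fun t ht x => h.norm_le t ⟨hs.trans_lt ht.1, ht.2⟩ x
  norm_drift_le := h.norm_drift_le
  mild := fun _ _ hs' hst ht x => h.mild (hs.trans_lt hs') hst ht x

end DriftMild

/-! ### The Duhamel integrand and its derivatives under the time integral -/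

section Duhamel

/-- The **Duhamel integrand** of a family `u` between `s` and `t`: `τ ↦ N_{t−τ}[u(τ), u(τ)]` on
`(s, t)` and `0` elsewhere (so that every slice is smooth, the junk value of `oseenSlice` at
non-positive times being cut off), with `oseenDuhamel 1 s u u t x = ∫_{(s,t)} (oseenDuhamelIntegrand
u s t τ) x dτ` (`oseenDuhamel_one_eq_integral_oseenDuhamelIntegrand`). [folklore] -/
def oseenDuhamelIntegrand (u : ℝ → E → E) (s t : ℝ) : ℝ → E → E :=
  (Ioo s t).indicator fun τ => oseenSlice (t - τ) (u τ) (u τ)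

variable {u : ℝ → E → E} {s t : ℝ}

/-- On `(s, t)` the Duhamel integrand is the slice `N_{t−τ}[u(τ), u(τ)]`. [folklore] -/
theorem oseenDuhamelIntegrand_of_mem {τ : ℝ} (hτ : τ ∈ Ioo s t) :
    oseenDuhamelIntegrand u s t τ = oseenSlice (t - τ) (u τ) (u τ) :=
  indicator_of_mem hτ _

/-- Off `(s, t)` the Duhamel integrand vanishes. [folklore] -/
theorem oseenDuhamelIntegrand_of_not_mem {τ : ℝ} (hτ : τ ∉ Ioo s t) : oseenDuhamelIntegrand u s t τ = 0 :=
  indicator_of_notMem hτ _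

/-- The tree's Duhamel term at viscosity `1` is the time integral of the Duhamel integrand:
`oseenDuhamel 1 s u u t x = ∫_{τ ∈ (s,t)} oseenDuhamelIntegrand u s t τ x dτ`. [folklore] -/
theorem oseenDuhamel_one_eq_integral_oseenDuhamelIntegrand (u : ℝ → E → E) (s t : ℝ) (x : E) :
    oseenDuhamel 1 s u u t x = ∫ τ in Ioo s t, oseenDuhamelIntegrand u s t τ x := by
  rw [oseenDuhamel_apply]
  refine setIntegral_congr_fun measurableSet_Ioo fun τ hτ => ?_
  rw [oseenDuhamelIntegrand_of_mem hτ, oseenSlice_apply, one_mul]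

/-- **Joint measurability** of the Duhamel integrand for a jointly measurable family. [folklore] -/
theorem stronglyMeasurable_uncurry_oseenDuhamelIntegrand (hu : Measurable (uncurry u)) :
    StronglyMeasurable (uncurry (oseenDuhamelIntegrand u s t)) := by
  have hS : MeasurableSet {q : ℝ × E | q.1 ∈ Ioo s t} := measurableSet_Ioo.preimage measurable_fst
  have hF : StronglyMeasurable (fun q : ℝ × E => oseenSlice (t - q.1) (u q.1) (u q.1) q.2) :=
    stronglyMeasurable_oseenSlice_param (measurable_const.sub measurable_id) hu hu
  have heq : uncurry (oseenDuhamelIntegrand u s t) =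
      {q : ℝ × E | q.1 ∈ Ioo s t}.piecewise
        (fun q : ℝ × E => oseenSlice (t - q.1) (u q.1) (u q.1) q.2) 0 := by
    funext q
    by_cases hq : q.1 ∈ Ioo s t
    · rw [piecewise_eq_of_mem _ _ _ (show q ∈ {q : ℝ × E | q.1 ∈ Ioo s t} from hq)]
      show oseenDuhamelIntegrand u s t q.1 q.2 = _
      rw [oseenDuhamelIntegrand_of_mem hq]
    · rw [piecewise_eq_of_notMem _ _ _ (show q ∉ {q : ℝ × E | q.1 ∈ Ioo s t} from hq)]
      show oseenDuhamelIntegrand u s t q.1 q.2 = _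
      rw [oseenDuhamelIntegrand_of_not_mem hq]; rfl
  rw [heq]
  exact hF.piecewise hS stronglyMeasurable_const

/-- **Every slice of the Duhamel integrand is smooth** when `u` is bounded and measurable on
`(s, t)`. [folklore] -/
theorem contDiff_oseenDuhamelIntegrand (hu : Measurable (uncurry u)) {M : ℝ}
    (hM : ∀ τ ∈ Ioo s t, ∀ y, ‖u τ y‖ ≤ M) (τ : ℝ) : ContDiff ℝ ∞ (oseenDuhamelIntegrand u s t τ) := by
  by_cases hτ : τ ∈ Ioo s t
  · rw [oseenDuhamelIntegrand_of_mem hτ]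
    have hm : Measurable (u τ) := hu.comp (measurable_const.prodMk measurable_id)
    exact contDiff_oseenSlice (sub_pos.2 hτ.2) hm hm (hM τ hτ) (hM τ hτ)
  · rw [oseenDuhamelIntegrand_of_not_mem hτ]
    exact contDiff_const

/-- Bound transfer: a bound valid on `(s, t)` for the slice, and nonnegative everywhere, bounds the
derivatives of the Duhamel integrand everywhere. [folklore] -/
theorem norm_iteratedFDeriv_oseenDuhamelIntegrand_le {i : ℕ} {B : ℝ → ℝ} (hB0 : ∀ τ, 0 ≤ B τ)
    (hB : ∀ τ ∈ Ioo s t, ∀ x, ‖iteratedFDeriv ℝ i (oseenSlice (t - τ) (u τ) (u τ)) x‖ ≤ B τ)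
    (τ : ℝ) (x : E) : ‖iteratedFDeriv ℝ i (oseenDuhamelIntegrand u s t τ) x‖ ≤ B τ := by
  by_cases hτ : τ ∈ Ioo s t
  · rw [oseenDuhamelIntegrand_of_mem hτ]; exact hB τ hτ x
  · rw [oseenDuhamelIntegrand_of_not_mem hτ, iteratedFDeriv_zero, Pi.zero_apply, norm_zero]
    exact hB0 τ

omit [FiniteDimensional ℝ E] [MeasurableSpace E] [BorelSpace E] in
/-- `‖D⁰f(x) − D⁰f(y)‖ = ‖f x − f y‖` (currying isometry). [folklore] -/
theorem norm_iteratedFDeriv_zero_sub_apply₂ {F : Type*} [NormedAddCommGroup F] [NormedSpace ℝ F]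
    (f : E → F) (x y : E) :
    ‖iteratedFDeriv ℝ 0 f x - iteratedFDeriv ℝ 0 f y‖ = ‖f x - f y‖ := by
  rw [iteratedFDeriv_zero_eq_comp, Function.comp_apply, Function.comp_apply, ← map_sub,
    LinearIsometryEquiv.norm_map]

/-- Integral of `‖(t − τ)ᵉ‖` over `(s, t)`, `e > −1`: the norm is invisible. [folklore] -/
theorem integral_Ioo_norm_sub_rpow {e : ℝ} (hst : s < t) (he : -1 < e) :
    IntegrableOn (fun τ => ‖(t - τ) ^ e‖) (Ioo s t) ∧
      ∫ τ in Ioo s t, ‖(t - τ) ^ e‖ = (t - s) ^ (e + 1) / (e + 1) := by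
  obtain ⟨hI, hval⟩ := integrableOn_Ioo_sub_rpow_and_integral_eq hst he
  refine ⟨hI.norm, ?_⟩
  rw [← hval]
  refine setIntegral_congr_fun measurableSet_Ioo fun τ hτ => ?_
  exact Real.norm_of_nonneg (Real.rpow_nonneg (sub_pos.2 hτ.2).le _)

/-- **The Duhamel term of bounded measurable data is `C^{0,1/2}`** (level `0` of the bootstrap):
there is `C = C(E)` with, for `s < t`, `u` jointly measurable and `‖u(τ)‖ ≤ M` on `(s, t)`,
`x ↦ B¹ₛ(u, u)(t)(x)` continuous, `‖B(x)‖ ≤ C M² (t − s)^{1/2}` (KNSS (4.5):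
`‖B(u,v)‖ ≤ C√T‖u‖‖v‖`) and `‖B(x) − B(y)‖ ≤ C M² (t − s)^{1/4} ‖x − y‖^{1/2}` (increments of the
slices are `≤ min(2C₀σ^{-1/2}, C₁σ⁻¹‖x − y‖) M² ≤ √(2C₀C₁) M² σ^{-3/4} ‖x − y‖^{1/2}`). [cite: KochNadirashviliSereginSverak2009, §4 (4.5) and (3.12) (arXiv:0709.3599v1 pp. 6–8)] -/
theorem exists_duhamel_holder_base :
    ∃ C : ℝ, 0 ≤ C ∧ ∀ {u : ℝ → E → E} {s t M : ℝ}, s < t → Measurable (uncurry u) →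
      (∀ τ ∈ Ioo s t, ∀ y, ‖u τ y‖ ≤ M) →
      Continuous (fun x => oseenDuhamel 1 s u u t x) ∧
      (∀ x, ‖oseenDuhamel 1 s u u t x‖ ≤ C * M ^ 2 * (t - s) ^ (1 / 2 : ℝ)) ∧
      (∀ x y, ‖oseenDuhamel 1 s u u t x - oseenDuhamel 1 s u u t y‖ ≤
        C * M ^ 2 * (t - s) ^ (1 / 4 : ℝ) * ‖x - y‖ ^ (1 / 2 : ℝ)) := by
  obtain ⟨C₀, hC₀, hN⟩ := exists_norm_oseenSlice_le (E := E)
  obtain ⟨C₁, hC₁, hD⟩ := exists_norm_fderiv_oseenSlice_le (E := E)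
  set K : ℝ := Real.sqrt (2 * C₀ * C₁) with hK
  have hK0 : 0 ≤ K := Real.sqrt_nonneg _
  have hK2 : K ^ 2 = 2 * C₀ * C₁ := Real.sq_sqrt (by positivity)
  refine ⟨max (2 * C₀) (4 * K), by positivity, fun {u s t M} hst hu hM => ?_⟩
  have hM0 : 0 ≤ M ^ 2 := sq_nonneg M
  -- the dominated-differentiation package at order `0`
  set Nd := oseenDuhamelIntegrand u s t with hNd
  have hmeas := stronglyMeasurable_uncurry_oseenDuhamelIntegrand (s := s) (t := t) hu
  have hsmooth := contDiff_oseenDuhamelIntegrand (s := s) (t := t) hu hM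
  set bound : ℕ → ℝ → ℝ := fun _ τ => C₀ * M ^ 2 * ‖(t - τ) ^ (-(1 / 2 : ℝ))‖ with hbound
  obtain ⟨hI, hIval⟩ := integral_Ioo_norm_sub_rpow (e := -(1 / 2 : ℝ)) hst (by norm_num)
  have hbi : ∀ i ≤ 0, Integrable (bound i) (volume.restrict (Ioo s t)) := fun i _ =>
    hI.const_mul (C₀ * M ^ 2)
  have hslice : ∀ τ ∈ Ioo s t, ∀ x, ‖oseenSlice (t - τ) (u τ) (u τ) x‖ ≤
      C₀ * (t - τ) ^ (-(1 / 2 : ℝ)) * M * M := fun τ hτ x => hN (sub_pos.2 hτ.2) (hM τ hτ) (hM τ hτ) x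
  have hb : ∀ i ≤ 0, ∀ τ x, ‖iteratedFDeriv ℝ i (Nd τ) x‖ ≤ bound i τ := by
    intro i hi τ x
    obtain rfl := Nat.le_zero.1 hi
    refine norm_iteratedFDeriv_oseenDuhamelIntegrand_le
      (B := fun τ => C₀ * M ^ 2 * ‖(t - τ) ^ (-(1 / 2 : ℝ))‖) (fun τ => by positivity)
      (fun τ hτ x => ?_) τ x
    rw [norm_iteratedFDeriv_zero]
    calc ‖oseenSlice (t - τ) (u τ) (u τ) x‖ ≤ C₀ * (t - τ) ^ (-(1 / 2 : ℝ)) * M * M := hslice τ hτ x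
      _ = C₀ * M ^ 2 * (t - τ) ^ (-(1 / 2 : ℝ)) := by ring
      _ ≤ C₀ * M ^ 2 * ‖(t - τ) ^ (-(1 / 2 : ℝ))‖ := by gcongr; exact Real.le_norm_self _
  have hpack := contDiff_integral_of_dominated_iteratedFDeriv (m := 0) hmeas hsmooth hbi hb
  have hfun : (fun x => oseenDuhamel 1 s u u t x) = fun x => ∫ τ in Ioo s t, Nd τ x :=
    funext fun x => oseenDuhamel_one_eq_integral_oseenDuhamelIntegrand u s t x
  refine ⟨?_, fun x => ?_, fun x y => ?_⟩
  · rw [hfun]; exact hpack.1.continuous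
  · have h := norm_iteratedFDeriv_integral_le hmeas hsmooth hbi hb (j := 0) le_rfl x
    rw [norm_iteratedFDeriv_zero] at h
    rw [oseenDuhamel_one_eq_integral_oseenDuhamelIntegrand]
    refine h.trans ?_
    simp only [hbound]
    rw [MeasureTheory.integral_const_mul, hIval]
    norm_num
    have : 0 ≤ (t - s) ^ (1 / 2 : ℝ) := Real.rpow_nonneg (sub_pos.2 hst).le _
    calc C₀ * M ^ 2 * ((t - s) ^ (1 / 2 : ℝ) / (1 / 2)) = (2 * C₀) * M ^ 2 * (t - s) ^ (1 / 2 : ℝ) := by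
          ring
      _ ≤ max (2 * C₀) (4 * K) * M ^ 2 * (t - s) ^ (1 / 2 : ℝ) := by gcongr; exact le_max_left _ _
  · -- increments
    set r : ℝ := ‖x - y‖ with hr
    have hr0 : 0 ≤ r := norm_nonneg _
    obtain ⟨hJ, hJval⟩ := integral_Ioo_norm_sub_rpow (e := -(3 / 4 : ℝ)) hst (by norm_num)
    set c : ℝ → ℝ := fun τ => K * M ^ 2 * r ^ (1 / 2 : ℝ) * ‖(t - τ) ^ (-(3 / 4 : ℝ))‖ with hc
    have hci : Integrable c (volume.restrict (Ioo s t)) := hJ.const_mul _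
    have hcb : ∀ τ, ‖iteratedFDeriv ℝ 0 (Nd τ) x - iteratedFDeriv ℝ 0 (Nd τ) y‖ ≤ c τ := by
      intro τ
      rw [norm_iteratedFDeriv_zero_sub_apply₂]
      by_cases hτ : τ ∈ Ioo s t
      · have hσ : 0 < t - τ := sub_pos.2 hτ.2
        simp only [hNd, oseenDuhamelIntegrand_of_mem hτ]
        set σ := t - τ with hσdef
        have hm : Measurable (u τ) := hu.comp (measurable_const.prodMk measurable_id)
        -- the two bounds
        have h1 : ‖oseenSlice σ (u τ) (u τ) x - oseenSlice σ (u τ) (u τ) y‖ ≤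
            2 * C₀ * M ^ 2 * σ ^ (-(1 / 2 : ℝ)) := by
          refine (norm_sub_le _ _).trans ?_
          calc ‖oseenSlice σ (u τ) (u τ) x‖ + ‖oseenSlice σ (u τ) (u τ) y‖
              ≤ C₀ * σ ^ (-(1 / 2 : ℝ)) * M * M + C₀ * σ ^ (-(1 / 2 : ℝ)) * M * M :=
                add_le_add (hslice τ hτ x) (hslice τ hτ y)
            _ = 2 * C₀ * M ^ 2 * σ ^ (-(1 / 2 : ℝ)) := by ring
        have h2 : ‖oseenSlice σ (u τ) (u τ) x - oseenSlice σ (u τ) (u τ) y‖ ≤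
            C₁ * M ^ 2 * σ ^ (-(1 : ℝ)) * r := by
          have hsm : Differentiable ℝ (oseenSlice σ (u τ) (u τ)) :=
            (contDiff_oseenSlice hσ hm hm (hM τ hτ) (hM τ hτ) (n := 1)).differentiable one_ne_zero
          have hmv := Convex.norm_image_sub_le_of_norm_fderiv_le (s := univ) (fun z _ => hsm z)
            (fun z _ => hD hσ hm hm (hM τ hτ) (hM τ hτ) z) convex_univ (mem_univ y) (mem_univ x)
          calc _ ≤ C₁ * σ ^ (-(1 : ℝ)) * M * M * ‖x - y‖ := hmv
            _ = C₁ * M ^ 2 * σ ^ (-(1 : ℝ)) * r := by rw [hr]; ring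
        -- geometric mean
        have hgm : ‖oseenSlice σ (u τ) (u τ) x - oseenSlice σ (u τ) (u τ) y‖ ≤
            K * M ^ 2 * r ^ (1 / 2 : ℝ) * σ ^ (-(3 / 4 : ℝ)) := by
          refine (le_min h1 h2).trans (min_le_of_mul_le_sq (by positivity) (by positivity)
            (by positivity) ?_)
          have hsq : (K * M ^ 2 * r ^ (1 / 2 : ℝ) * σ ^ (-(3 / 4 : ℝ))) ^ 2 =
              K ^ 2 * (M ^ 2) ^ 2 * (r ^ (1 / 2 : ℝ)) ^ 2 * (σ ^ (-(3 / 4 : ℝ))) ^ 2 := by ring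
          have hr2 : (r ^ (1 / 2 : ℝ)) ^ 2 = r := by
            rw [← Real.rpow_natCast, ← Real.rpow_mul hr0]; norm_num
          have hσ2 : (σ ^ (-(3 / 4 : ℝ))) ^ 2 = σ ^ (-(1 / 2 : ℝ)) * σ ^ (-(1 : ℝ)) := by
            rw [← Real.rpow_natCast, ← Real.rpow_mul hσ.le, ← Real.rpow_add hσ]; norm_num
          rw [hsq, hK2, hr2, hσ2]
          have : 0 ≤ σ ^ (-(1 / 2 : ℝ)) * σ ^ (-(1 : ℝ)) := by positivity
          nlinarith [this, hM0]
        refine hgm.trans (le_of_eq ?_)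
        simp only [hc]
        rw [Real.norm_of_nonneg (Real.rpow_nonneg hσ.le _)]
      · simp only [hNd, oseenDuhamelIntegrand_of_not_mem hτ, Pi.zero_apply, sub_self, norm_zero]
        positivity
    have h := norm_iteratedFDeriv_integral_sub_le hmeas hsmooth hbi hb (j := 0) le_rfl hci hcb
    rw [norm_iteratedFDeriv_zero_sub_apply₂] at h
    rw [oseenDuhamel_one_eq_integral_oseenDuhamelIntegrand, oseenDuhamel_one_eq_integral_oseenDuhamelIntegrand]
    refine h.trans ?_
    simp only [hc]
    rw [MeasureTheory.integral_const_mul, hJval]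
    norm_num
    have : 0 ≤ M ^ 2 * r ^ (1 / 2 : ℝ) * (t - s) ^ (1 / 4 : ℝ) := by
      have := Real.rpow_nonneg (sub_pos.2 hst).le (1 / 4 : ℝ); positivity
    calc K * M ^ 2 * r ^ (1 / 2 : ℝ) * ((t - s) ^ (1 / 4 : ℝ) / (1 / 4))
        = (4 * K) * (M ^ 2 * r ^ (1 / 2 : ℝ) * (t - s) ^ (1 / 4 : ℝ)) := by ring
      _ ≤ max (2 * C₀) (4 * K) * (M ^ 2 * r ^ (1 / 2 : ℝ) * (t - s) ^ (1 / 4 : ℝ)) := by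
          gcongr; exact le_max_right _ _
      _ = max (2 * C₀) (4 * K) * M ^ 2 * (t - s) ^ (1 / 4 : ℝ) * r ^ (1 / 2 : ℝ) := by ring

/-- **The Duhamel term of `C^{k,1/2}` data is `C^{k+1,1/2}`** (the gain step of the
bootstrap): there is `C = C(k, E)` with, for `s < t`, `u` jointly measurable and
`u(τ) ∈ C^{k,1/2}` with constant `A` for `τ ∈ (s, t)`: `B = B¹ₛ(u, u)(t) ∈ Cᵏ⁺¹`,
`‖Dᵏ⁺¹B(x)‖ ≤ C A² (t − s)^{1/4}` and `‖Dᵏ⁺¹B(x) − Dᵏ⁺¹B(y)‖ ≤ C A² ‖x − y‖^{1/2}` (derivatives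
under the time integral with the bounds `L σ^{-1/2}` (orders `≤ k`), `G σ^{-3/4}` (order `k + 1`)
of `OseenSliceHolder`; the Hölder bound by `‖Dᵏ⁺²N_σ‖ ≤ G σ^{-5/4} A²`, the mean value
inequality and the splitting integral `∫ min(2σ^{-3/4}, rσ^{-5/4}) ≤ 12 r^{1/2}`). This is the
mild-form rendering of "Equation (4.8) gains `ω` one spatial derivative" (KNSS p. 8). [cite: KochNadirashviliSereginSverak2009, §4 (4.7)–(4.10) with (3.12)–(3.13) (arXiv:0709.3599v1 pp. 6–8)] -/
theorem exists_duhamel_holder_step (k : ℕ) :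
    ∃ C : ℝ, 0 ≤ C ∧ ∀ {u : ℝ → E → E} {s t A : ℝ}, s < t → Measurable (uncurry u) →
      (∀ τ ∈ Ioo s t, IsHolderField k (1 / 2) A (u τ)) →
      ContDiff ℝ (k + 1) (fun x => oseenDuhamel 1 s u u t x) ∧
      (∀ x, ‖iteratedFDeriv ℝ (k + 1) (fun x => oseenDuhamel 1 s u u t x) x‖ ≤
        C * A ^ 2 * (t - s) ^ (1 / 4 : ℝ)) ∧
      (∀ x y, ‖iteratedFDeriv ℝ (k + 1) (fun x => oseenDuhamel 1 s u u t x) x -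
          iteratedFDeriv ℝ (k + 1) (fun x => oseenDuhamel 1 s u u t x) y‖ ≤
        C * A ^ 2 * ‖x - y‖ ^ (1 / 2 : ℝ)) := by
  obtain ⟨L, hL, hLow⟩ := exists_norm_iteratedFDeriv_oseenSlice_le_of_isCkBounded (E := E) k
  obtain ⟨G, hG, hGain⟩ := exists_holder_gain_oseenSlice (E := E) k
  refine ⟨12 * G, by positivity, fun {u s t A} hst hu hH => ?_⟩
  have hA : 0 ≤ A := (hH ((s + t) / 2) ⟨by linarith, by linarith⟩).nonneg
  have hA2 : 0 ≤ A ^ 2 := sq_nonneg A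
  have hbdd : ∀ τ ∈ Ioo s t, ∀ y, ‖u τ y‖ ≤ A := fun τ hτ y => (hH τ hτ).norm_apply_le y
  -- clean exponents for the gain bounds
  have hG1 : ∀ τ ∈ Ioo s t, ∀ x,
      ‖iteratedFDeriv ℝ (k + 1) (oseenSlice (t - τ) (u τ) (u τ)) x‖ ≤
        G * (t - τ) ^ (-(3 / 4 : ℝ)) * A * A := fun τ hτ x => by
    have := (hGain (sub_pos.2 hτ.2) (by norm_num) (by norm_num) (hH τ hτ) (hH τ hτ) x).1
    convert this using 3; norm_num
  have hG2 : ∀ τ ∈ Ioo s t, ∀ x,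
      ‖iteratedFDeriv ℝ (k + 2) (oseenSlice (t - τ) (u τ) (u τ)) x‖ ≤
        G * (t - τ) ^ (-(5 / 4 : ℝ)) * A * A := fun τ hτ x => by
    have := (hGain (sub_pos.2 hτ.2) (by norm_num) (by norm_num) (hH τ hτ) (hH τ hτ) x).2
    convert this using 3; norm_num
  -- the dominated-differentiation package at order `k + 1`
  set Nd := oseenDuhamelIntegrand u s t with hNd
  have hmeas := stronglyMeasurable_uncurry_oseenDuhamelIntegrand (s := s) (t := t) hu
  have hsmooth := contDiff_oseenDuhamelIntegrand (s := s) (t := t) hu hbdd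
  set bound : ℕ → ℝ → ℝ := fun i τ => if i ≤ k then L * A ^ 2 * ‖(t - τ) ^ (-(1 / 2 : ℝ))‖
    else G * A ^ 2 * ‖(t - τ) ^ (-(3 / 4 : ℝ))‖ with hbound
  obtain ⟨hI, -⟩ := integral_Ioo_norm_sub_rpow (e := -(1 / 2 : ℝ)) hst (by norm_num)
  obtain ⟨hJ, hJval⟩ := integral_Ioo_norm_sub_rpow (e := -(3 / 4 : ℝ)) hst (by norm_num)
  have hbi : ∀ i ≤ k + 1, Integrable (bound i) (volume.restrict (Ioo s t)) := by
    intro i _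
    by_cases hik : i ≤ k
    · simp only [hbound, if_pos hik]; exact hI.const_mul _
    · simp only [hbound, if_neg hik]; exact hJ.const_mul _
  have hb : ∀ i ≤ k + 1, ∀ τ x, ‖iteratedFDeriv ℝ i (Nd τ) x‖ ≤ bound i τ := by
    intro i hi τ x
    by_cases hik : i ≤ k
    · simp only [hbound, if_pos hik]
      refine norm_iteratedFDeriv_oseenDuhamelIntegrand_le
        (B := fun τ => L * A ^ 2 * ‖(t - τ) ^ (-(1 / 2 : ℝ))‖) (fun τ => by positivity)
        (fun τ hτ x => ?_) τ x
      calc ‖iteratedFDeriv ℝ i (oseenSlice (t - τ) (u τ) (u τ)) x‖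
          ≤ L * (t - τ) ^ (-(1 / 2 : ℝ)) * A * A :=
            hLow (sub_pos.2 hτ.2) (hH τ hτ).isCkBounded (hH τ hτ).isCkBounded i hik x
        _ = L * A ^ 2 * (t - τ) ^ (-(1 / 2 : ℝ)) := by ring
        _ ≤ L * A ^ 2 * ‖(t - τ) ^ (-(1 / 2 : ℝ))‖ := by gcongr; exact Real.le_norm_self _
    · obtain rfl : i = k + 1 := by omega
      simp only [hbound, if_neg hik]
      refine norm_iteratedFDeriv_oseenDuhamelIntegrand_le
        (B := fun τ => G * A ^ 2 * ‖(t - τ) ^ (-(3 / 4 : ℝ))‖) (fun τ => by positivity)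
        (fun τ hτ x => ?_) τ x
      calc ‖iteratedFDeriv ℝ (k + 1) (oseenSlice (t - τ) (u τ) (u τ)) x‖
          ≤ G * (t - τ) ^ (-(3 / 4 : ℝ)) * A * A := hG1 τ hτ x
        _ = G * A ^ 2 * (t - τ) ^ (-(3 / 4 : ℝ)) := by ring
        _ ≤ G * A ^ 2 * ‖(t - τ) ^ (-(3 / 4 : ℝ))‖ := by gcongr; exact Real.le_norm_self _
  have hpack := contDiff_integral_of_dominated_iteratedFDeriv (m := k + 1) hmeas hsmooth hbi hb
  have hfun : (fun x => oseenDuhamel 1 s u u t x) = fun x => ∫ τ in Ioo s t, Nd τ x :=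
    funext fun x => oseenDuhamel_one_eq_integral_oseenDuhamelIntegrand u s t x
  rw [hfun]
  have hnk : ¬ (k + 1 ≤ k) := Nat.not_succ_le_self k
  refine ⟨hpack.1, fun x => ?_, fun x y => ?_⟩
  · have h := norm_iteratedFDeriv_integral_le hmeas hsmooth hbi hb (j := k + 1) le_rfl x
    refine h.trans ?_
    simp only [hbound, if_neg hnk]
    rw [MeasureTheory.integral_const_mul, hJval]
    norm_num
    have : 0 ≤ (t - s) ^ (1 / 4 : ℝ) := Real.rpow_nonneg (sub_pos.2 hst).le _
    calc G * A ^ 2 * ((t - s) ^ (1 / 4 : ℝ) / (1 / 4)) = (4 * G) * A ^ 2 * (t - s) ^ (1 / 4 : ℝ) := by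
          ring
      _ ≤ 12 * G * A ^ 2 * (t - s) ^ (1 / 4 : ℝ) := by gcongr; norm_num
  · -- increments of the top derivative
    set r : ℝ := ‖x - y‖ with hr
    have hr0 : 0 ≤ r := norm_nonneg _
    rcases hr0.eq_or_lt with hrz | hrp
    · have hxy : x = y := by rwa [hr, eq_comm, norm_sub_eq_zero_iff] at hrz
      rw [hxy, sub_self, norm_zero]; positivity
    obtain ⟨hKint, hKval⟩ := integral_Ioo_min_rpow_le hst hrp
    set c : ℝ → ℝ := fun τ =>
      G * A ^ 2 * ‖min (2 * (t - τ) ^ (-(3 / 4 : ℝ))) (r * (t - τ) ^ (-(5 / 4 : ℝ)))‖ with hc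
    have hci : Integrable c (volume.restrict (Ioo s t)) := hKint.norm.const_mul _
    have hcb : ∀ τ, ‖iteratedFDeriv ℝ (k + 1) (Nd τ) x - iteratedFDeriv ℝ (k + 1) (Nd τ) y‖ ≤ c τ := by
      intro τ
      by_cases hτ : τ ∈ Ioo s t
      · have hσ : 0 < t - τ := sub_pos.2 hτ.2
        simp only [hNd, oseenDuhamelIntegrand_of_mem hτ]
        set σ := t - τ with hσdef
        have hm : Measurable (u τ) := hu.comp (measurable_const.prodMk measurable_id)
        have hsm : ContDiff ℝ (k + 1 + 1 : ℕ) (oseenSlice σ (u τ) (u τ)) :=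
          contDiff_oseenSlice hσ hm hm (hbdd τ hτ) (hbdd τ hτ)
        have h1 : ‖iteratedFDeriv ℝ (k + 1) (oseenSlice σ (u τ) (u τ)) x -
            iteratedFDeriv ℝ (k + 1) (oseenSlice σ (u τ) (u τ)) y‖ ≤ 2 * (G * σ ^ (-(3 / 4 : ℝ)) * A * A) :=
          (norm_sub_le _ _).trans (by linarith [hG1 τ hτ x, hG1 τ hτ y])
        have h2 : ‖iteratedFDeriv ℝ (k + 1) (oseenSlice σ (u τ) (u τ)) x -
            iteratedFDeriv ℝ (k + 1) (oseenSlice σ (u τ) (u τ)) y‖ ≤ (G * σ ^ (-(5 / 4 : ℝ)) * A * A) * r :=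
          norm_iteratedFDeriv_sub_le_of_bound hsm (hG2 τ hτ) x y
        have hmin := le_min h1 h2
        refine hmin.trans ?_
        simp only [hc]
        have hGA : 0 ≤ G * A ^ 2 := by positivity
        calc min (2 * (G * σ ^ (-(3 / 4 : ℝ)) * A * A)) (G * σ ^ (-(5 / 4 : ℝ)) * A * A * r)
            = G * A ^ 2 * min (2 * σ ^ (-(3 / 4 : ℝ))) (r * σ ^ (-(5 / 4 : ℝ))) := by
              rw [mul_min_of_nonneg _ _ hGA]; congr 1 <;> ring
          _ ≤ G * A ^ 2 * ‖min (2 * σ ^ (-(3 / 4 : ℝ))) (r * σ ^ (-(5 / 4 : ℝ)))‖ := by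
              gcongr; exact Real.le_norm_self _
      · simp only [hNd, oseenDuhamelIntegrand_of_not_mem hτ, iteratedFDeriv_zero, Pi.zero_apply, sub_self,
          norm_zero]
        positivity
    have h := norm_iteratedFDeriv_integral_sub_le hmeas hsmooth hbi hb (j := k + 1) le_rfl hci hcb
    refine h.trans ?_
    simp only [hc]
    rw [MeasureTheory.integral_const_mul]
    have hnorm : ∫ τ in Ioo s t, ‖min (2 * (t - τ) ^ (-(3 / 4 : ℝ))) (r * (t - τ) ^ (-(5 / 4 : ℝ)))‖ =
        ∫ τ in Ioo s t, min (2 * (t - τ) ^ (-(3 / 4 : ℝ))) (r * (t - τ) ^ (-(5 / 4 : ℝ))) := by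
      refine setIntegral_congr_fun measurableSet_Ioo fun τ hτ => Real.norm_of_nonneg ?_
      have : 0 < t - τ := sub_pos.2 hτ.2
      exact le_min (by positivity) (by positivity)
    rw [hnorm]
    calc G * A ^ 2 * ∫ τ in Ioo s t, min (2 * (t - τ) ^ (-(3 / 4 : ℝ))) (r * (t - τ) ^ (-(5 / 4 : ℝ)))
        ≤ G * A ^ 2 * (12 * r ^ (1 / 2 : ℝ)) := by gcongr
      _ = 12 * G * A ^ 2 * r ^ (1 / 2 : ℝ) := by ring

end Duhamel

/-! ### The heat part `e^{dΔ}U(s)` -/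

section Heat

variable {g : E → E} {d N A : ℝ}

/-- **The free part of bounded data is `C^{0,1/2}`**: for `g` measurable with `‖g‖ ≤ N` and
`d > 0`, `e^{dΔ}g` is smooth, bounded by `N`, and
`‖e^{dΔ}g(x) − e^{dΔ}g(y)‖ ≤ √(2N · 2^{dim/2} d^{-1/2} N) ‖x − y‖^{1/2}` (the minimum of the
oscillation bound `2N` and the Lipschitz bound from `‖∇e^{dΔ}g‖ ≤ 2^{dim/2}d^{-1/2}N`). [folklore] -/
theorem heat_holder_base (hg : Measurable g) (hN : ∀ y, ‖g y‖ ≤ N) (hd : 0 < d) (x y : E) :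
    ‖heatExtension g d x - heatExtension g d y‖ ≤
      Real.sqrt (2 * N * ((2 : ℝ) ^ ((Module.finrank ℝ E : ℝ) / 2) * d ^ (-(1 / 2 : ℝ)) * N)) *
        ‖x - y‖ ^ (1 / 2 : ℝ) := by
  have hN0 : 0 ≤ N := (norm_nonneg _).trans (hN x)
  set Lip : ℝ := (2 : ℝ) ^ ((Module.finrank ℝ E : ℝ) / 2) * d ^ (-(1 / 2 : ℝ)) * N with hLip
  have hLip0 : 0 ≤ Lip := by positivity
  set K : ℝ := Real.sqrt (2 * N * Lip) with hK
  have hK2 : K ^ 2 = 2 * N * Lip := Real.sq_sqrt (by positivity)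
  set r : ℝ := ‖x - y‖ with hr
  have hr0 : 0 ≤ r := norm_nonneg _
  have h1 : ‖heatExtension g d x - heatExtension g d y‖ ≤ 2 * N :=
    (norm_sub_le _ _).trans (by
      linarith [UnboundedOperators.norm_heatExtension_le_of_bound hN hd x,
        UnboundedOperators.norm_heatExtension_le_of_bound hN hd y])
  have h2 : ‖heatExtension g d x - heatExtension g d y‖ ≤ Lip * r := by
    have hsm : Differentiable ℝ (heatExtension g d) :=
      (UnboundedOperators.contDiff_heatExtension_holds (memLp_top_of_bound hg.aestronglyMeasurable
        N (Eventually.of_forall hN)) le_top hd).differentiable (by simp)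
    exact Convex.norm_image_sub_le_of_norm_fderiv_le (s := univ) (fun z _ => hsm z)
      (fun z _ => UnboundedOperators.norm_fderiv_heatExtension_le_of_bounded hg.aestronglyMeasurable
        hN hd z) convex_univ (mem_univ y) (mem_univ x)
  refine (le_min h1 h2).trans (min_le_of_mul_le_sq (by positivity) (by positivity) (by positivity) ?_)
  have hr2 : (r ^ (1 / 2 : ℝ)) ^ 2 = r := by
    rw [← Real.rpow_natCast, ← Real.rpow_mul hr0]; norm_num
  have : 2 * N * (Lip * r) = (K * r ^ (1 / 2 : ℝ)) ^ 2 := by rw [mul_pow, hr2, hK2]; ring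
  exact this.le

/-- **The free part of `Cᵏ`-bounded data gains derivatives with `1/2`-Hölder control**: for
`g ∈ Cᵏ` with `‖Dʲg‖ ≤ A` (`j ≤ k`), measurable, and `d > 0`, with `P = 2^{dim/2} d^{-1/2} A` and
`Q = 2^{dim/2} (d/2)^{-1/2} max(A, 2^{dim/2}(d/2)^{-1/2}A)`: `‖Dᵏ⁺¹e^{dΔ}g‖ ≤ P`,
`‖Dᵏ⁺²e^{dΔ}g‖ ≤ Q` (two one-derivative gains across `e^{dΔ} = e^{(d/2)Δ}e^{(d/2)Δ}`), and
`‖Dᵏ⁺¹e^{dΔ}g(x) − Dᵏ⁺¹e^{dΔ}g(y)‖ ≤ √(2PQ) ‖x − y‖^{1/2}`. [folklore] -/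
theorem heat_holder_step {k : ℕ} (hgk : IsCkBounded k A g) (hd : 0 < d) :
    (∀ x, ‖iteratedFDeriv ℝ (k + 1) (heatExtension g d) x‖ ≤
      (2 : ℝ) ^ ((Module.finrank ℝ E : ℝ) / 2) * d ^ (-(1 / 2 : ℝ)) * A) ∧
    (∀ x, ‖iteratedFDeriv ℝ (k + 2) (heatExtension g d) x‖ ≤
      (2 : ℝ) ^ ((Module.finrank ℝ E : ℝ) / 2) * (d / 2) ^ (-(1 / 2 : ℝ)) *
        max A ((2 : ℝ) ^ ((Module.finrank ℝ E : ℝ) / 2) * (d / 2) ^ (-(1 / 2 : ℝ)) * A)) ∧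
    (∀ x y, ‖iteratedFDeriv ℝ (k + 1) (heatExtension g d) x -
        iteratedFDeriv ℝ (k + 1) (heatExtension g d) y‖ ≤
      Real.sqrt (2 * ((2 : ℝ) ^ ((Module.finrank ℝ E : ℝ) / 2) * d ^ (-(1 / 2 : ℝ)) * A) *
        ((2 : ℝ) ^ ((Module.finrank ℝ E : ℝ) / 2) * (d / 2) ^ (-(1 / 2 : ℝ)) *
          max A ((2 : ℝ) ^ ((Module.finrank ℝ E : ℝ) / 2) * (d / 2) ^ (-(1 / 2 : ℝ)) * A))) *
        ‖x - y‖ ^ (1 / 2 : ℝ)) := by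
  set P : ℝ := (2 : ℝ) ^ ((Module.finrank ℝ E : ℝ) / 2) * d ^ (-(1 / 2 : ℝ)) * A with hPdef
  set Q : ℝ := (2 : ℝ) ^ ((Module.finrank ℝ E : ℝ) / 2) * (d / 2) ^ (-(1 / 2 : ℝ)) *
      max A ((2 : ℝ) ^ ((Module.finrank ℝ E : ℝ) / 2) * (d / 2) ^ (-(1 / 2 : ℝ)) * A) with hQdef
  have hA : 0 ≤ A := hgk.nonneg
  have hd2 : 0 < d / 2 := half_pos hd
  set c2 : ℝ := (2 : ℝ) ^ ((Module.finrank ℝ E : ℝ) / 2) with hc2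
  have hmeas : Measurable g := hgk.contDiff.continuous.measurable
  have hbd : ∀ y, ‖g y‖ ≤ A := hgk.norm_apply_le
  have hmem : MemLp g ∞ (volume : Measure E) :=
    memLp_top_of_bound hmeas.aestronglyMeasurable A (Eventually.of_forall hbd)
  -- first gain
  have hP : ∀ x, ‖iteratedFDeriv ℝ (k + 1) (heatExtension g d) x‖ ≤ P := fun x =>
    UnboundedOperators.norm_iteratedFDeriv_succ_heatExtension_le_of_bounded hgk.contDiff
      (C := fun _ => A) hgk.norm_le hd x
  -- the half-time flow and its bounds up to order `k + 1`
  set g' : E → E := heatExtension g (d / 2) with hg'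
  have hsemi : heatExtension g d = heatExtension g' (d / 2) := by
    rw [hg', UnboundedOperators.heatExtension_add_holds hmem le_top hd2 hd2, add_halves]
  have hg'k : ContDiff ℝ (k + 1 : ℕ) g' :=
    (UnboundedOperators.contDiff_heatExtension_holds hmem le_top hd2).of_le (by exact_mod_cast le_top)
  set C' : ℕ → ℝ := fun j => if j ≤ k then A else c2 * (d / 2) ^ (-(1 / 2 : ℝ)) * A with hC'
  have hC'b : ∀ j ≤ k + 1, ∀ z, ‖iteratedFDeriv ℝ j g' z‖ ≤ C' j := by
    intro j hj z
    by_cases hjk : j ≤ k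
    · simp only [hC', if_pos hjk]
      exact UnboundedOperators.norm_iteratedFDeriv_heatExtension_le_of_bounded hgk.contDiff
        (C := fun _ => A) hgk.norm_le hd2 hjk z
    · obtain rfl : j = k + 1 := by omega
      simp only [hC', if_neg hjk]
      exact UnboundedOperators.norm_iteratedFDeriv_succ_heatExtension_le_of_bounded hgk.contDiff
        (C := fun _ => A) hgk.norm_le hd2 z
  have hQ : ∀ x, ‖iteratedFDeriv ℝ (k + 2) (heatExtension g d) x‖ ≤ Q := by
    intro x
    rw [hsemi]
    refine (UnboundedOperators.norm_iteratedFDeriv_succ_heatExtension_le_of_bounded (n := k + 1) hg'k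
      hC'b hd2 x).trans ?_
    have hnk : ¬ (k + 1 ≤ k) := Nat.not_succ_le_self k
    simp only [hC', if_neg hnk, hQdef, hc2]
    gcongr
    exact le_max_right _ _
  refine ⟨hP, hQ, fun x y => ?_⟩
  -- Hölder-1/2 of the `(k+1)`-st derivative
  have hP0 : 0 ≤ P := (norm_nonneg _).trans (hP x)
  have hQ0 : 0 ≤ Q := (norm_nonneg _).trans (hQ x)
  set r : ℝ := ‖x - y‖ with hr
  have hr0 : 0 ≤ r := norm_nonneg _
  have hsm : ContDiff ℝ (k + 1 + 1 : ℕ) (heatExtension g d) :=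
    (UnboundedOperators.contDiff_heatExtension_holds hmem le_top hd).of_le (by exact_mod_cast le_top)
  have h1 : ‖iteratedFDeriv ℝ (k + 1) (heatExtension g d) x -
      iteratedFDeriv ℝ (k + 1) (heatExtension g d) y‖ ≤ 2 * P :=
    (norm_sub_le _ _).trans (by linarith [hP x, hP y])
  have h2 : ‖iteratedFDeriv ℝ (k + 1) (heatExtension g d) x -
      iteratedFDeriv ℝ (k + 1) (heatExtension g d) y‖ ≤ Q * r :=
    norm_iteratedFDeriv_sub_le_of_bound hsm hQ x y
  refine (le_min h1 h2).trans (min_le_of_mul_le_sq (by positivity) (by positivity) (by positivity) ?_)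
  have hK2 : (Real.sqrt (2 * P * Q)) ^ 2 = 2 * P * Q := Real.sq_sqrt (by positivity)
  have hr2 : (r ^ (1 / 2 : ℝ)) ^ 2 = r := by
    rw [← Real.rpow_natCast, ← Real.rpow_mul hr0]; norm_num
  have : 2 * P * (Q * r) = (Real.sqrt (2 * P * Q) * r ^ (1 / 2 : ℝ)) ^ 2 := by
    rw [mul_pow, hr2, hK2]; ring
  exact this.le

end Heat

/-! ### The bootstrap -/

section Levels

omit [FiniteDimensional ℝ E] [MeasurableSpace E] [BorelSpace E] in
/-- Enlarging the constant of `C^{k,α}` data. [folklore] -/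
theorem IsHolderField.of_le_const {F : Type*} [NormedAddCommGroup F] [NormedSpace ℝ F]
    {k : ℕ} {α A B : ℝ} {a : E → F} (h : IsHolderField k α A a) (hAB : A ≤ B) :
    IsHolderField k α B a :=
  ⟨h.contDiff, fun j hj x => (h.norm_le j hj x).trans hAB, fun x y =>
    (h.holder x y).trans (mul_le_mul_of_nonneg_right hAB (Real.rpow_nonneg (norm_nonneg _) _))⟩

variable {s₀ T N : ℝ} {U : ℝ → E → E} {b : ℝ → E}

/-- The drift-mild identity at lag `d`: `U(t) = e^{dΔ}U(t − d) − B¹_{t−d}(u, u)(t)` as functions.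
[folklore] -/
theorem IsDriftMildOn.eq_heat_sub_duhamel (h : IsDriftMildOn s₀ T N U b) {t d : ℝ} (hd : 0 < d)
    (hs : s₀ < t - d) (ht : t < T) :
    U t = heatExtension (U (t - d)) d -
      fun x => oseenDuhamel 1 (t - d) (fun τ y => U τ y + b τ) (fun τ y => U τ y + b τ) t x := by
  funext x
  have := h.mild hs (by linarith) ht x
  rwa [sub_sub_cancel] at this

/-- **Level `0` of the bootstrap**: for `δ > 0` and `N ≥ 0` there is `A₀ = A₀(δ, N, E)` such that
every drift-mild pair with bound `N` on `(s₀, T)` has `U(t) ∈ C^{0,1/2}` with constant `A₀` for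
all `t ∈ (s₀ + δ, T)` (restart at `s = t − δ/2`: the free part by `heat_holder_base`, the Duhamel
part by `exists_duhamel_holder_base`). [cite: KochNadirashviliSereginSverak2009, §4 closing paragraph, (4.10) with k = 0 (arXiv:0709.3599v1 p. 8)] -/
theorem exists_isHolderField_zero_of_isDriftMildOn {δ N : ℝ} (hδ : 0 < δ) (hN : 0 ≤ N) :
    ∃ A : ℝ, ∀ {s₀ T : ℝ} {U : ℝ → E → E} {b : ℝ → E}, IsDriftMildOn s₀ T N U b →
      ∀ t ∈ Ioo (s₀ + δ) T, IsHolderField 0 (1 / 2) A (U t) := by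
  obtain ⟨Cb, hCb0, hCb⟩ := exists_duhamel_holder_base (E := E)
  set d : ℝ := δ / 2 with hd
  have hd0 : 0 < d := half_pos hδ
  set Kh : ℝ := Real.sqrt (2 * N * ((2 : ℝ) ^ ((Module.finrank ℝ E : ℝ) / 2) * d ^ (-(1 / 2 : ℝ)) * N))
    with hKh
  set Cd : ℝ := Cb * (2 * N) ^ 2 * d ^ (1 / 4 : ℝ) with hCd
  have hKh0 : 0 ≤ Kh := Real.sqrt_nonneg _
  have hCd0 : 0 ≤ Cd := by positivity
  refine ⟨N + Kh + Cd, fun {s₀ T U b} h t ht => ?_⟩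
  -- the restart time
  have hs : s₀ < t - d := by have := ht.1; linarith
  have hst : t - d < t := by linarith
  have hsT : t - d ∈ Ioo s₀ T := ⟨hs, hst.trans ht.2⟩
  have htT : t ∈ Ioo s₀ T := ⟨by linarith, ht.2⟩
  set uu : ℝ → E → E := fun τ y => U τ y + b τ with huu
  have huum : Measurable (uncurry uu) := h.measurable_full
  have huub : ∀ τ ∈ Ioo (t - d) t, ∀ y, ‖uu τ y‖ ≤ 2 * N := fun τ hτ y =>
    h.norm_full_le ⟨hs.trans hτ.1, hτ.2.trans ht.2⟩ y
  have hmild := h.eq_heat_sub_duhamel hd0 hs ht.2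
  obtain ⟨hDc, -, hDh⟩ := hCb hst huum huub
  have hgm : Measurable (U (t - d)) := h.measurable_slice (t - d)
  have hgb : ∀ y, ‖U (t - d) y‖ ≤ N := h.norm_le (t - d) hsT
  have hS : ContDiff ℝ ∞ (heatExtension (U (t - d)) d) :=
    UnboundedOperators.contDiff_heatExtension_holds (memLp_top_of_bound hgm.aestronglyMeasurable N
      (Eventually.of_forall hgb)) le_top hd0
  -- the three clauses
  have hcont : Continuous (U t) := by
    rw [hmild]; exact hS.continuous.sub hDc
  have hhol : ∀ x y, ‖U t x - U t y‖ ≤ (Kh + Cd) * ‖x - y‖ ^ (1 / 2 : ℝ) := by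
    intro x y
    rw [hmild]
    simp only [Pi.sub_apply]
    rw [sub_sub_sub_comm]
    refine (norm_sub_le _ _).trans ?_
    have h1 := heat_holder_base hgm hgb hd0 x y
    have h2 := hDh x y
    rw [sub_sub_cancel] at h2
    calc _ ≤ Kh * ‖x - y‖ ^ (1 / 2 : ℝ) + Cb * (2 * N) ^ 2 * d ^ (1 / 4 : ℝ) * ‖x - y‖ ^ (1 / 2 : ℝ) :=
          add_le_add h1 h2
      _ = (Kh + Cd) * ‖x - y‖ ^ (1 / 2 : ℝ) := by rw [hCd]; ring
  refine ⟨contDiff_zero.2 hcont, fun j hj x => ?_, fun x y => ?_⟩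
  · obtain rfl := Nat.le_zero.1 hj
    rw [norm_iteratedFDeriv_zero]
    exact (h.norm_le t htT x).trans (by linarith)
  · rw [norm_iteratedFDeriv_zero_sub_apply₂]
    refine (hhol x y).trans (mul_le_mul_of_nonneg_right (by linarith) ?_)
    exact Real.rpow_nonneg (norm_nonneg _) _

/-- **The gain step of the bootstrap**: if every drift-mild pair with bound `N` has
`U(τ) ∈ C^{k,1/2}` with constant `A` on `(s₀ + δ/2, T)`, then every such pair has
`U(t) ∈ C^{k+1,1/2}` with a constant `A' = A'(k, δ, N, A, E)` on `(s₀ + δ, T)` (restart at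
`s = t − δ/2`; the free part by `heat_holder_step`, the Duhamel part — with data
`u(τ) = U(τ) + b(τ) ∈ C^{k,1/2}`, constant `A + N` — by `exists_duhamel_holder_step`). [cite: KochNadirashviliSereginSverak2009, §4 closing paragraph, (4.7)–(4.10) (arXiv:0709.3599v1 p. 8)] -/
theorem exists_isHolderField_succ_of_isDriftMildOn (k : ℕ) {δ N : ℝ} (hδ : 0 < δ)
    {A : ℝ} (hIH : ∀ {s₀ T : ℝ} {U : ℝ → E → E} {b : ℝ → E}, IsDriftMildOn s₀ T N U b →
      ∀ t ∈ Ioo (s₀ + δ / 2) T, IsHolderField k (1 / 2) A (U t)) :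
    ∃ A' : ℝ, ∀ {s₀ T : ℝ} {U : ℝ → E → E} {b : ℝ → E}, IsDriftMildOn s₀ T N U b →
      ∀ t ∈ Ioo (s₀ + δ) T, IsHolderField (k + 1) (1 / 2) A' (U t) := by
  obtain ⟨Cs, hCs0, hCs⟩ := exists_duhamel_holder_step (E := E) k
  set d : ℝ := δ / 2 with hd
  have hd0 : 0 < d := half_pos hδ
  set c2 : ℝ := (2 : ℝ) ^ ((Module.finrank ℝ E : ℝ) / 2) with hc2
  set P : ℝ := c2 * d ^ (-(1 / 2 : ℝ)) * A with hP
  set Q : ℝ := c2 * (d / 2) ^ (-(1 / 2 : ℝ)) * max A (c2 * (d / 2) ^ (-(1 / 2 : ℝ)) * A) with hQ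
  set Kh : ℝ := Real.sqrt (2 * P * Q) with hKh
  set CD1 : ℝ := Cs * (A + N) ^ 2 * d ^ (1 / 4 : ℝ) with hCD1
  set CD2 : ℝ := Cs * (A + N) ^ 2 with hCD2
  refine ⟨A + P + Kh + CD1 + CD2, fun {s₀ T U b} h t ht => ?_⟩
  -- the restart time and the induction hypothesis on `(s₀ + δ/2, T)`
  have hs : s₀ < t - d := by have := ht.1; linarith
  have hst : t - d < t := by linarith
  have hUt : IsHolderField k (1 / 2) A (U t) := hIH h t ⟨by have := ht.1; linarith, ht.2⟩
  have hUs : IsHolderField k (1 / 2) A (U (t - d)) :=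
    hIH h (t - d) ⟨by have := ht.1; linarith, hst.trans ht.2⟩
  have hA : 0 ≤ A := hUt.nonneg
  have hP0 : 0 ≤ P := by positivity
  have hQ0 : 0 ≤ Q := by positivity
  have hKh0 : 0 ≤ Kh := Real.sqrt_nonneg _
  have hCD10 : 0 ≤ CD1 := by positivity
  have hCD20 : 0 ≤ CD2 := by positivity
  set uu : ℝ → E → E := fun τ y => U τ y + b τ with huu
  have huum : Measurable (uncurry uu) := h.measurable_full
  have huuH : ∀ τ ∈ Ioo (t - d) t, IsHolderField k (1 / 2) (A + N) (uu τ) := fun τ hτ =>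
    ((hIH h τ ⟨by have := hτ.1; have := ht.1; linarith, hτ.2.trans ht.2⟩).add_const (b τ)).of_le_const
      (by linarith [h.norm_drift_le τ])
  have hmild := h.eq_heat_sub_duhamel hd0 hs ht.2
  obtain ⟨hDk, hDb, hDh⟩ := hCs hst huum huuH
  obtain ⟨hSP, -, hSh⟩ := heat_holder_step (d := d) hUs.isCkBounded hd0
  have hgm : Measurable (U (t - d)) := h.measurable_slice (t - d)
  have hS : ContDiff ℝ ∞ (heatExtension (U (t - d)) d) :=
    UnboundedOperators.contDiff_heatExtension_holds (memLp_top_of_bound hgm.aestronglyMeasurable A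
      (Eventually.of_forall hUs.norm_apply_le)) le_top hd0
  have hSk : ContDiff ℝ (k + 1 : ℕ) (heatExtension (U (t - d)) d) := hS.of_le (by exact_mod_cast le_top)
  -- the three clauses at order `k + 1`
  refine ⟨?_, fun j hj x => ?_, fun x y => ?_⟩
  · rw [hmild]; exact hSk.sub hDk
  · by_cases hjk : j ≤ k
    · exact (hUt.norm_le j hjk x).trans (by linarith)
    · obtain rfl : j = k + 1 := by omega
      rw [hmild, iteratedFDeriv_sub_apply hSk.contDiffAt hDk.contDiffAt]
      refine (norm_sub_le _ _).trans ?_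
      have h1 := hSP x
      have h2 := hDb x
      rw [sub_sub_cancel] at h2
      calc _ ≤ P + Cs * (A + N) ^ 2 * d ^ (1 / 4 : ℝ) := add_le_add h1 h2
        _ ≤ A + P + Kh + CD1 + CD2 := by rw [hCD1]; linarith
  · rw [hmild, iteratedFDeriv_sub_apply hSk.contDiffAt hDk.contDiffAt,
      iteratedFDeriv_sub_apply hSk.contDiffAt hDk.contDiffAt, sub_sub_sub_comm]
    refine (norm_sub_le _ _).trans ?_
    have h1 := hSh x y
    have h2 := hDh x y
    have hr : 0 ≤ ‖x - y‖ ^ (1 / 2 : ℝ) := Real.rpow_nonneg (norm_nonneg _) _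
    calc _ ≤ Kh * ‖x - y‖ ^ (1 / 2 : ℝ) + Cs * (A + N) ^ 2 * ‖x - y‖ ^ (1 / 2 : ℝ) := add_le_add h1 h2
      _ = (Kh + CD2) * ‖x - y‖ ^ (1 / 2 : ℝ) := by rw [hCD2]; ring
      _ ≤ (A + P + Kh + CD1 + CD2) * ‖x - y‖ ^ (1 / 2 : ℝ) := by gcongr; linarith

/-- **The bootstrap** (KNSS 2009, §4, (4.10), for drift-mild pairs): for every `k`, `δ > 0` and
`N ≥ 0` there is `A = A(k, δ, N, E)` such that every drift-mild pair with bound `N` on `(s₀, T)`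
has `U(t) ∈ C^{k,1/2}` with constant `A` for all `t ∈ (s₀ + δ, T)` (induction on `k`, halving
`δ` at each level). [cite: KochNadirashviliSereginSverak2009, §4 closing paragraph, (4.10) (arXiv:0709.3599v1 p. 8)] -/
theorem exists_isHolderField_of_isDriftMildOn (k : ℕ) {δ N : ℝ} (hδ : 0 < δ) (hN : 0 ≤ N) :
    ∃ A : ℝ, ∀ {s₀ T : ℝ} {U : ℝ → E → E} {b : ℝ → E}, IsDriftMildOn s₀ T N U b →
      ∀ t ∈ Ioo (s₀ + δ) T, IsHolderField k (1 / 2) A (U t) := by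
  induction k generalizing δ with
  | zero => exact exists_isHolderField_zero_of_isDriftMildOn hδ hN
  | succ k ih =>
    obtain ⟨A, hA⟩ := ih (half_pos hδ)
    exact exists_isHolderField_succ_of_isDriftMildOn k hδ hA

/-- **Smoothness of the slices** (KNSS 2009, §4: bounded weak solutions are smooth in `x`): every
slice `U(t)`, `s₀ < t < T`, of a drift-mild pair is `C^∞`. [cite: KochNadirashviliSereginSverak2009, §4 (4.10) (arXiv:0709.3599v1 p. 8)] -/
theorem IsDriftMildOn.contDiff (h : IsDriftMildOn s₀ T N U b) {t : ℝ} (ht : t ∈ Ioo s₀ T) :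
    ContDiff ℝ ∞ (U t) := by
  refine contDiff_infty.2 fun k => ?_
  have hδ : 0 < (t - s₀) / 2 := by have := ht.1; linarith
  obtain ⟨A, hA⟩ := exists_isHolderField_of_isDriftMildOn (E := E) k hδ h.nonneg
  exact (hA h t ⟨by linarith, ht.2⟩).contDiff

/-- **KNSS 2009, (4.10), for drift-mild pairs**: for all `k`, `δ > 0`, `N ≥ 0` there is
`C = C(k, δ, N, E)` such that every drift-mild pair with bound `N` on `(s₀, T)` satisfies
`‖DᵏU(t)(x)‖ ≤ C` for all `t ∈ (s₀ + δ, T)` and all `x` — the bound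
`‖∇ᵏₓu‖_{L^∞(ℝⁿ×(δ,T))} ≤ C(k, δ, T, M)` of the source for `u − b = U`, with constants independent of
`T` and of the pair. [cite: KochNadirashviliSereginSverak2009, §4 (4.10) (arXiv:0709.3599v1 p. 8)] -/
theorem IsDriftMildOn.exists_norm_iteratedFDeriv_le (k : ℕ) {δ N : ℝ} (hδ : 0 < δ) (hN : 0 ≤ N) :
    ∃ C : ℝ, ∀ {s₀ T : ℝ} {U : ℝ → E → E} {b : ℝ → E}, IsDriftMildOn s₀ T N U b →
      ∀ t ∈ Ioo (s₀ + δ) T, ∀ x, ‖iteratedFDeriv ℝ k (U t) x‖ ≤ C := by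
  obtain ⟨A, hA⟩ := exists_isHolderField_of_isDriftMildOn (E := E) k hδ hN
  exact ⟨A, fun h t ht x => (hA h t ht).norm_le k le_rfl x⟩

/-- The `1/2`-Hölder (in particular Lipschitz-free) spatial control of every derivative:
`‖DᵏU(t)(x) − DᵏU(t)(y)‖ ≤ C ‖x − y‖^{1/2}` on `(s₀ + δ, T)`, same uniformity. [cite: KochNadirashviliSereginSverak2009, §4 (4.9)–(4.10) (arXiv:0709.3599v1 p. 8)] -/
theorem IsDriftMildOn.exists_norm_iteratedFDeriv_sub_le (k : ℕ) {δ N : ℝ} (hδ : 0 < δ) (hN : 0 ≤ N) :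
    ∃ C : ℝ, ∀ {s₀ T : ℝ} {U : ℝ → E → E} {b : ℝ → E}, IsDriftMildOn s₀ T N U b →
      ∀ t ∈ Ioo (s₀ + δ) T, ∀ x y,
        ‖iteratedFDeriv ℝ k (U t) x - iteratedFDeriv ℝ k (U t) y‖ ≤ C * ‖x - y‖ ^ (1 / 2 : ℝ) := by
  obtain ⟨A, hA⟩ := exists_isHolderField_of_isDriftMildOn (E := E) k hδ hN
  exact ⟨A, fun h t ht x y => (hA h t ht).holder x y⟩

end Levels

end Literature.Analysis.FluidPDE

end
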